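/-
Copyright (c) 2026 the pub-hodgecm-mathlib formalisation cell (harness21).  Prover seat hodgecm-mathlib-K2E3-p23 (g6), HCML Track B «K2-LIT» ∕ h413
(`stmt-HodgeConjecture-24833`), line `K2_E3_EllipticInputs`, road «GL₂-sc» (road owner K2E5-p17 (g5), dealer K2E3-plan (g4)), NON-ELLIPTIC half, brick 2N-0d:
the `Fin 2` twin of ★ (N0) `K2E3GL3CharpolyDiscNullHaar` (K2E3-p17 (g7)) + ★ B4-1m `K2E3GL3ModUniformizerSeparableAE` (K2E3-p03 (g4)) — HAAR-A.E. `g ∈ GL₂(F)` IS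
REGULAR SEMISIMPLE, THE A.E. NORMAL-FORM DICHOTOMY, AND THEIR IMAGES IN `G' = GL₂(F) ⧸ ϖ^ℤ·1`.  2026-09-04.
-/
import Summits.HodgeConjecture.HodgeConjecture.Theorems.K2E3GL2ModUniformizerHaarTransfer          -- ★ 2N-0c F2 (this seat): `ae_of_ae_comp_mk` (the a.e.-transfer `GL₂(F) → G'`)
import Summits.HodgeConjecture.HodgeConjecture.Theorems.K2E3GL2ModUniformizerCentralizerCompact    -- ★ 2N-0b F2 (this seat): `isCompact_centralizer_mk_of_irreducible`; brings F1 (dichotomy, `exists_conj_diagonal_of_card_roots_eq_two`)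
import Summits.HodgeConjecture.HodgeConjecture.Theorems.K2E3GL3CharpolyDiscNullHaar               -- ★ (N0) (K2E3-p17 g7): GENERIC §1 `measure_setOf_coe_mem_eq_zero`, `ae_coe_of_ae` (`dX`-null ⇒ Haar-null on `GL_n`)
import Summits.HodgeConjecture.HodgeConjecture.Theorems.K2E3GL2RegularSetLimitDensity              -- ★ (K2E3-p12 g5): `measure_setOf_discr_charpoly_eq_zero` on `𝔤𝔩₂(F)`
import HarnessLib

/-!
# Road «GL₂-sc», non-elliptic half, brick 2N-0d — Haar-a.e. regular semisimplicity on `GL₂(F)` and `G' = GL₂(F) ⧸ ϖ^ℤ·1`, and the a.e. normal-form dichotomy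

Cell `pub/hodgecm-mathlib` (D-0151), Track B «K2-LIT», crux H413 = `stmt-HodgeConjecture-24833`, route of record `HCCMUnconditional`.  Lane
`--supports stmt-HodgeConjecture-24833 --as helper`; THEOREMS ONLY (no `def`, no `instance`, no `notation`, no named-fact hypothesis, no `sorry`); count-neutral.
`Fin 2` reading of ★ (N0) `K2E3GL3CharpolyDiscNullHaar` §2–§3 and ★ B4-1m F3 `K2E3GL3ModUniformizerSeparableAE` (road «GL-[M6]-sc»); the generic §1 of (N0)
(`dX`-null sets of `M_n(F)` are Haar-null in `GL_n(F)`) and the `𝔤𝔩₂` singular-set nullity ★ `K2E3GL2RegularSetLimitDensity.measure_setOf_discr_charpoly_eq_zero`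
are IMPORTED.  At `N = 2` the normal form is a DICHOTOMY: split (`y·diag d·y⁻¹`, `d` injective) ∨ elliptic (`χ` irreducible) — no mixed case.

§1 (`GL₂(F)`): **`measure_setOf_discr_charpoly_eq_zero`** (`ρ {g | disc χ_g = 0} = 0` for every Haar `ρ`), `ae_discr_charpoly_ne_zero`, `ae_discr_charpoly_conj_ne_zero`;
**`normalForm_of_discr_ne_zero`** (any field: `disc χ_X ≠ 0 ⇒ (∃ y d, d injective ∧ X = y·diag d·y⁻¹) ∨ Irreducible χ_X`), `exists_conj_diagonal_iff_card_roots_eq_two`,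
**`ae_discr_ne_zero_and_normalForm`**.
§2 (`G'`): `isOpen_setOf_discr_charpoly_ne_zero`, `measurableSet_setOf_exists_mk_eq_discr_ne_zero`, **`ae_exists_mk_eq_discr_ne_zero`** (Haar-a.e. `x ∈ G'` has a
regular semisimple lift), `ae_exists_mk_eq_separable`, **`ae_exists_mk_eq_normalForm`**, **`ae_isCompact_centralizer_or_normalForm`** (a.e. `x`: `Z_{G'}(x)` compact ∨
`x = mk (y·diag d·y⁻¹)` with `χ` separable, `d` injective — the ASM form of the case split).
[HarishChandra1970, Part VII §3; HarishChandra1999AdmissibleDistributions, §7; WeilBNT1967, Ch. I §4; Cartier1979, §I.3–I.4]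
HONEST LABEL: HC_CM is proved only modulo the 7 printed citations (2 remaining named inputs: hLiu418 = stmt-HodgeConjecture-24832, h413 =
stmt-HodgeConjecture-24833) until rung 0 closes; count-neutral helper.

## References
* [HarishChandra1970] Harish-Chandra (notes by G. van Dijk), *Harmonic Analysis on Reductive p-adic Groups*, LNM 162 (1970), Part VII §3.
* [HarishChandra1999AdmissibleDistributions] Harish-Chandra (notes by DeBacker–Sally), *Admissible Invariant Distributions on Reductive p-adic Groups* (1999), §7.
* [WeilBNT1967] A. Weil, *Basic Number Theory* (1967), Ch. I §4.
* [Cartier1979] P. Cartier, *Representations of p-adic groups: a survey*, Corvallis (1979), §I.3–I.4.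
-/

set_option autoImplicit false
set_option linter.dupNamespace false   -- `Summit.HodgeConjecture.HodgeConjecture.…` (D-0017 nested layout; lakefile exemption for Summits)

noncomputable section

open MeasureTheory MeasureTheory.Measure Set Matrix Topology Polynomial
open scoped MatrixGroups NNReal ENNReal WithZero
open Literature.NumberTheory.GaloisRepresentations.IsNonarchimedeanLocalField
open Literature.NumberTheory.Automorphic
open Summit.HodgeConjecture.HodgeConjecture.Cruxes.H413.K2E3CharpolyRootsPerturbation (separable_of_discr_ne_zero)
open Summit.HodgeConjecture.HodgeConjecture.Cruxes.H413.K2E3GL3ModUniformizerCentralizerTrichotomy (irreducible_charpoly_two_iff_card_roots_eq_zero)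
open Summit.HodgeConjecture.HodgeConjecture.Cruxes.H413.K2E3GL3CharpolyDiscNullHaar (measure_setOf_coe_mem_eq_zero ae_coe_of_ae)
open Summit.HodgeConjecture.HodgeConjecture.Cruxes.H413.K2E3GL2ModCentre
open Summit.HodgeConjecture.HodgeConjecture.Cruxes.H413.K2E3GL2ModUniformizerCentralizerDichotomy
open Summit.HodgeConjecture.HodgeConjecture.Cruxes.H413.K2E3GL2ModUniformizerCentralizerCompact
open Summit.HodgeConjecture.HodgeConjecture.Cruxes.H413.K2E3GL2ModUniformizerHaarTransfer

namespace Summit.HodgeConjecture.HodgeConjecture.Cruxes.H413.K2E3GL2ModUniformizerSeparableAE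

/-! ## §1  The singular set `{disc χ_g = 0}` of `GL₂(F)` is Haar-null; the a.e. normal-form dichotomy upstairs -/

section DiscNull

variable {F : Type*} [Field F] [ValuativeRel F] [TopologicalSpace F] [IsNonarchimedeanLocalField F]
variable [MeasurableSpace (GL (Fin 2) F)] [BorelSpace (GL (Fin 2) F)]

/-- **(N0) `ρ {g ∈ GL₂(F) | disc χ_g = 0} = 0` for every Haar measure `ρ` of `GL₂(F)`** (★ `𝔤𝔩₂` nullity + ★ generic transfer; auxiliary Borel structures and an
additive Haar measure of `M₂(F)` are chosen inside the proof). [cite: HarishChandra1970, Part VII §3] [cite: HarishChandra1999AdmissibleDistributions, §7] [cite: WeilBNT1967, Ch. I §4] -/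
theorem measure_setOf_discr_charpoly_eq_zero (ρ : Measure (GL (Fin 2) F)) [ρ.IsHaarMeasure] :
    ρ {g : GL (Fin 2) F | (g : Matrix (Fin 2) (Fin 2) F).charpoly.discr = 0} = 0 := by
  haveI : T2Space F := (isLocalField F).toT2Space
  haveI : LocallyCompactSpace F := (isLocalField F).toLocallyCompactSpace
  haveI : IsTopologicalRing F := inferInstance
  haveI : LocallyCompactSpace (Matrix (Fin 2) (Fin 2) F) := Pi.locallyCompactSpace_of_finite
  letI : MeasurableSpace F := borel F
  haveI : BorelSpace F := ⟨rfl⟩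
  letI : MeasurableSpace (Matrix (Fin 2) (Fin 2) F) := borel _
  haveI : BorelSpace (Matrix (Fin 2) (Fin 2) F) := ⟨rfl⟩
  set dX : Measure (Matrix (Fin 2) (Fin 2) F) := Measure.addHaar with hdX
  exact measure_setOf_coe_mem_eq_zero dX ρ (K2E3GL2RegularSetLimitDensity.measure_setOf_discr_charpoly_eq_zero dX)

/-- **(N0, a.e. form) Haar-a.e. `g ∈ GL₂(F)` is regular semisimple: `disc χ_g ≠ 0`.** [cite: HarishChandra1970, Part VII §3] [cite: HarishChandra1999AdmissibleDistributions, §7] -/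
theorem ae_discr_charpoly_ne_zero (ρ : Measure (GL (Fin 2) F)) [ρ.IsHaarMeasure] :
    ∀ᵐ (g : GL (Fin 2) F) ∂ρ, (g : Matrix (Fin 2) (Fin 2) F).charpoly.discr ≠ 0 := by
  rw [ae_iff]
  simp only [not_not]
  exact measure_setOf_discr_charpoly_eq_zero ρ

/-- (N0, conjugation form) for every `x ∈ GL₂(F)`, Haar-a.e. `g` has `disc χ_{x g x⁻¹} ≠ 0` (`χ` is a class function). [cite: HarishChandra1970, Part VII §3] -/
theorem ae_discr_charpoly_conj_ne_zero (ρ : Measure (GL (Fin 2) F)) [ρ.IsHaarMeasure] (x : GL (Fin 2) F) :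
    ∀ᵐ (g : GL (Fin 2) F) ∂ρ, ((x * g * x⁻¹ : GL (Fin 2) F) : Matrix (Fin 2) (Fin 2) F).charpoly.discr ≠ 0 := by
  filter_upwards [ae_discr_charpoly_ne_zero ρ] with g hg
  rwa [Units.val_mul, Units.val_mul, Matrix.coe_units_inv, Matrix.charpoly_units_conj]

end DiscNull

section NormalForm

variable {K : Type*} [Field K]

/-- **Regular semisimple DICHOTOMY in normal-form currency** (any field `K`, `X ∈ 𝔤𝔩₂(K)` with `disc χ_X ≠ 0`): EITHER `X = y·diagonal d·y⁻¹` with `d` injective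
(split: two rational eigenvalues) OR `χ_X` is irreducible (elliptic).  (`#roots χ_X ∈ {0, 2}`, ★ 2N-0b.) [cite: HarishChandra1970, Part VII §3] [cite: PlatonovRapinchuk1994, §3.3] -/
theorem normalForm_of_discr_ne_zero (X : Matrix (Fin 2) (Fin 2) K) (hD : X.charpoly.discr ≠ 0) :
    (∃ (y : GL (Fin 2) K) (d : Fin 2 → K), Function.Injective d ∧
        X = (y : Matrix (Fin 2) (Fin 2) K) * Matrix.diagonal d * ((y⁻¹ : GL (Fin 2) K) : Matrix (Fin 2) (Fin 2) K)) ∨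
      Irreducible X.charpoly := by
  rcases card_roots_charpoly_two_eq_zero_or_two X with h0 | h2
  · exact Or.inr ((irreducible_charpoly_two_iff_card_roots_eq_zero X).2 h0)
  · exact Or.inl (exists_conj_diagonal_of_card_roots_eq_two X h2 hD)

/-- **Split iff `#roots χ_X = 2`** (for `disc χ_X ≠ 0`). [cite: HarishChandra1970, Part VII §3] -/
theorem exists_conj_diagonal_iff_card_roots_eq_two (X : Matrix (Fin 2) (Fin 2) K) (hD : X.charpoly.discr ≠ 0) :
    (∃ (y : GL (Fin 2) K) (d : Fin 2 → K), Function.Injective d ∧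
        X = (y : Matrix (Fin 2) (Fin 2) K) * Matrix.diagonal d * ((y⁻¹ : GL (Fin 2) K) : Matrix (Fin 2) (Fin 2) K)) ↔
      X.charpoly.roots.card = 2 := by
  constructor
  · rintro ⟨y, d, -, hX⟩
    rw [hX]
    exact card_roots_charpoly_conj_diagonal y
  · exact fun h2 => exists_conj_diagonal_of_card_roots_eq_two X h2 hD

variable {F : Type*} [Field F] [ValuativeRel F] [TopologicalSpace F] [IsNonarchimedeanLocalField F]
variable [MeasurableSpace (GL (Fin 2) F)] [BorelSpace (GL (Fin 2) F)]

/-- **(N0 + a.e. normal form) Haar-a.e. `g ∈ GL₂(F)` is regular semisimple AND either split-diagonalisable or elliptic.** [cite: HarishChandra1970, Part VII §3] -/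
theorem ae_discr_ne_zero_and_normalForm (ρ : Measure (GL (Fin 2) F)) [ρ.IsHaarMeasure] :
    ∀ᵐ (g : GL (Fin 2) F) ∂ρ, (g : Matrix (Fin 2) (Fin 2) F).charpoly.discr ≠ 0 ∧
      ((∃ (y : GL (Fin 2) F) (d : Fin 2 → F), Function.Injective d ∧
          (g : Matrix (Fin 2) (Fin 2) F) = (y : Matrix (Fin 2) (Fin 2) F) * Matrix.diagonal d * ((y⁻¹ : GL (Fin 2) F) : Matrix (Fin 2) (Fin 2) F)) ∨
        Irreducible (g : Matrix (Fin 2) (Fin 2) F).charpoly) := by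
  filter_upwards [ae_discr_charpoly_ne_zero ρ] with g hg
  exact ⟨hg, normalForm_of_discr_ne_zero _ hg⟩

end NormalForm

/-! ## §2  Downstairs on `G' = GL₂(F) ⧸ ϖ^ℤ·1` -/

section Downstairs

variable {F : Type*} [Field F] [Valued F ℤᵐ⁰] [ValuativeRel F] [(Valued.v : Valuation F ℤᵐ⁰).Compatible] [IsNonarchimedeanLocalField F]

omit [(Valued.v : Valuation F ℤᵐ⁰).Compatible] in
/-- The regular semisimple set `{g ∈ GL₂(F) | disc χ_g ≠ 0}` is open (★ `continuous_discr_charpoly`). [cite: HarishChandra1999AdmissibleDistributions, §7] -/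
theorem isOpen_setOf_discr_charpoly_ne_zero : IsOpen {g : GL (Fin 2) F | (g : Matrix (Fin 2) (Fin 2) F).charpoly.discr ≠ 0} :=
  isOpen_ne_fun ((K2E3NormalizedCharBddNearSemisimpleRegular.continuous_discr_charpoly (R := F) (n := Fin 2)).comp Units.continuous_val) continuous_const

variable {ϖ : F} (hϖ : Valued.v ϖ = WithZero.exp (-1 : ℤ)) (hϖ0 : ϖ ≠ 0)
  [((Subgroup.zpowers (Units.mk0 ϖ hϖ0)).map (Matrix.GeneralLinearGroup.scalar (Fin 2))).Normal]
  [MeasurableSpace (GL (Fin 2) F ⧸ (Subgroup.zpowers (Units.mk0 ϖ hϖ0)).map (Matrix.GeneralLinearGroup.scalar (Fin 2)))]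
  [BorelSpace (GL (Fin 2) F ⧸ (Subgroup.zpowers (Units.mk0 ϖ hϖ0)).map (Matrix.GeneralLinearGroup.scalar (Fin 2)))]

omit [(Valued.v : Valuation F ℤᵐ⁰).Compatible] [((Subgroup.zpowers (Units.mk0 ϖ hϖ0)).map (Matrix.GeneralLinearGroup.scalar (Fin 2))).Normal] in
/-- `{x ∈ G' | ∃ g, mk g = x ∧ disc χ_g ≠ 0} = mk({disc ≠ 0})` is open (`mk` is an open map), hence measurable. [cite: Cartier1979, §I.3] -/
theorem measurableSet_setOf_exists_mk_eq_discr_ne_zero :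
    MeasurableSet {x : GL (Fin 2) F ⧸ (Subgroup.zpowers (Units.mk0 ϖ hϖ0)).map (Matrix.GeneralLinearGroup.scalar (Fin 2)) |
      ∃ g : GL (Fin 2) F, (QuotientGroup.mk g : GL (Fin 2) F ⧸ (Subgroup.zpowers (Units.mk0 ϖ hϖ0)).map (Matrix.GeneralLinearGroup.scalar (Fin 2))) = x ∧
        (g : Matrix (Fin 2) (Fin 2) F).charpoly.discr ≠ 0} := by
  have h : {x : GL (Fin 2) F ⧸ (Subgroup.zpowers (Units.mk0 ϖ hϖ0)).map (Matrix.GeneralLinearGroup.scalar (Fin 2)) |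
      ∃ g : GL (Fin 2) F, (QuotientGroup.mk g : GL (Fin 2) F ⧸ (Subgroup.zpowers (Units.mk0 ϖ hϖ0)).map (Matrix.GeneralLinearGroup.scalar (Fin 2))) = x ∧
        (g : Matrix (Fin 2) (Fin 2) F).charpoly.discr ≠ 0} =
      (QuotientGroup.mk : GL (Fin 2) F → GL (Fin 2) F ⧸ (Subgroup.zpowers (Units.mk0 ϖ hϖ0)).map (Matrix.GeneralLinearGroup.scalar (Fin 2))) ''
        {g : GL (Fin 2) F | (g : Matrix (Fin 2) (Fin 2) F).charpoly.discr ≠ 0} := by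
    ext x
    simp only [Set.mem_setOf_eq, Set.mem_image]
    constructor
    · rintro ⟨g, hg, hd⟩
      exact ⟨g, hd, hg⟩
    · rintro ⟨g, hd, hg⟩
      exact ⟨g, hg, hd⟩
  have ho : IsOpen ((QuotientGroup.mk : GL (Fin 2) F → GL (Fin 2) F ⧸ (Subgroup.zpowers (Units.mk0 ϖ hϖ0)).map (Matrix.GeneralLinearGroup.scalar (Fin 2))) ''
      {g : GL (Fin 2) F | (g : Matrix (Fin 2) (Fin 2) F).charpoly.discr ≠ 0}) :=
    QuotientGroup.isOpenMap_coe _ isOpen_setOf_discr_charpoly_ne_zero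
  rw [h]
  exact ho.measurableSet

include hϖ in
/-- **Haar-a.e. `x ∈ G'` has a regular semisimple lift**: `∀ᵐ x ∂μ', ∃ g, mk g = x ∧ disc χ_g ≠ 0` (★ (N0) upstairs for Mathlib's `Measure.haar` on `GL₂(F)`,
★ 2N-0c F2 `ae_of_ae_comp_mk`). [cite: HarishChandra1970, Part VII §3; cite: HarishChandra1999AdmissibleDistributions, §7] -/
theorem ae_exists_mk_eq_discr_ne_zero
    (μ' : Measure (GL (Fin 2) F ⧸ (Subgroup.zpowers (Units.mk0 ϖ hϖ0)).map (Matrix.GeneralLinearGroup.scalar (Fin 2)))) [μ'.IsHaarMeasure] :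
    ∀ᵐ x ∂μ', ∃ g : GL (Fin 2) F, (QuotientGroup.mk g : GL (Fin 2) F ⧸ (Subgroup.zpowers (Units.mk0 ϖ hϖ0)).map (Matrix.GeneralLinearGroup.scalar (Fin 2))) = x ∧
      (g : Matrix (Fin 2) (Fin 2) F).charpoly.discr ≠ 0 := by
  letI : MeasurableSpace (GL (Fin 2) F) := borel _
  haveI : BorelSpace (GL (Fin 2) F) := ⟨rfl⟩
  haveI : LocallyCompactSpace (GL (Fin 2) F) := locallyCompactSpace_gl2 F
  exact ae_of_ae_comp_mk hϖ hϖ0 (Measure.haar : Measure (GL (Fin 2) F)) μ' (measurableSet_setOf_exists_mk_eq_discr_ne_zero hϖ0)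
    ((ae_discr_charpoly_ne_zero (Measure.haar : Measure (GL (Fin 2) F))).mono fun g hg => ⟨g, rfl, hg⟩)

include hϖ in
/-- **Haar-a.e. `x ∈ G'` has a lift with SEPARABLE characteristic polynomial** (★ `separable_of_discr_ne_zero`). [cite: HarishChandra1970, Part VII §3] -/
theorem ae_exists_mk_eq_separable
    (μ' : Measure (GL (Fin 2) F ⧸ (Subgroup.zpowers (Units.mk0 ϖ hϖ0)).map (Matrix.GeneralLinearGroup.scalar (Fin 2)))) [μ'.IsHaarMeasure] :
    ∀ᵐ x ∂μ', ∃ g : GL (Fin 2) F, (QuotientGroup.mk g : GL (Fin 2) F ⧸ (Subgroup.zpowers (Units.mk0 ϖ hϖ0)).map (Matrix.GeneralLinearGroup.scalar (Fin 2))) = x ∧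
      (g : Matrix (Fin 2) (Fin 2) F).charpoly.Separable := by
  filter_upwards [ae_exists_mk_eq_discr_ne_zero hϖ hϖ0 μ'] with x hx
  obtain ⟨g, hgx, hD⟩ := hx
  exact ⟨g, hgx, separable_of_discr_ne_zero (Matrix.charpoly_monic _) (by rw [Matrix.charpoly_natDegree_eq_dim, Fintype.card_fin]; norm_num) hD⟩

include hϖ in
/-- **Haar-a.e. `x ∈ G'` has a regular semisimple lift in NORMAL FORM**: split (`y·diag d·y⁻¹`, `d` injective) ∨ elliptic (`χ` irreducible).
[cite: HarishChandra1970, Part VII §3; cite: HarishChandra1999AdmissibleDistributions, §7] -/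
theorem ae_exists_mk_eq_normalForm
    (μ' : Measure (GL (Fin 2) F ⧸ (Subgroup.zpowers (Units.mk0 ϖ hϖ0)).map (Matrix.GeneralLinearGroup.scalar (Fin 2)))) [μ'.IsHaarMeasure] :
    ∀ᵐ x ∂μ', ∃ g : GL (Fin 2) F, (QuotientGroup.mk g : GL (Fin 2) F ⧸ (Subgroup.zpowers (Units.mk0 ϖ hϖ0)).map (Matrix.GeneralLinearGroup.scalar (Fin 2))) = x ∧
      (g : Matrix (Fin 2) (Fin 2) F).charpoly.discr ≠ 0 ∧
      ((∃ (y : GL (Fin 2) F) (d : Fin 2 → F), Function.Injective d ∧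
          (g : Matrix (Fin 2) (Fin 2) F) = (y : Matrix (Fin 2) (Fin 2) F) * Matrix.diagonal d * ((y⁻¹ : GL (Fin 2) F) : Matrix (Fin 2) (Fin 2) F)) ∨
        Irreducible (g : Matrix (Fin 2) (Fin 2) F).charpoly) := by
  filter_upwards [ae_exists_mk_eq_discr_ne_zero hϖ hϖ0 μ'] with x hx
  obtain ⟨g, hgx, hD⟩ := hx
  exact ⟨g, hgx, hD, normalForm_of_discr_ne_zero _ hD⟩

include hϖ in
/-- **THE ASM FORM of the a.e. case split at `N = 2`**: for Haar-a.e. `x ∈ G'`, EITHER the centraliser `Z_{G'}(x)` is COMPACT (elliptic, ★ 2N-0b), OR `x = mk g`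
with `χ_g` separable and `g = y·diag d·y⁻¹`, `d` injective (split).  There is no mixed case.
[cite: HarishChandra1970, Part VII §3 pp. 70–73; cite: Cartier1979, §I.3–I.4] -/
theorem ae_isCompact_centralizer_or_normalForm
    (μ' : Measure (GL (Fin 2) F ⧸ (Subgroup.zpowers (Units.mk0 ϖ hϖ0)).map (Matrix.GeneralLinearGroup.scalar (Fin 2)))) [μ'.IsHaarMeasure] :
    ∀ᵐ x ∂μ', IsCompact ((Subgroup.centralizer {x} : Subgroup (GL (Fin 2) F ⧸ (Subgroup.zpowers (Units.mk0 ϖ hϖ0)).map (Matrix.GeneralLinearGroup.scalar (Fin 2)))) :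
        Set (GL (Fin 2) F ⧸ (Subgroup.zpowers (Units.mk0 ϖ hϖ0)).map (Matrix.GeneralLinearGroup.scalar (Fin 2)))) ∨
      ∃ g : GL (Fin 2) F, (QuotientGroup.mk g : GL (Fin 2) F ⧸ (Subgroup.zpowers (Units.mk0 ϖ hϖ0)).map (Matrix.GeneralLinearGroup.scalar (Fin 2))) = x ∧
        (g : Matrix (Fin 2) (Fin 2) F).charpoly.Separable ∧
        ∃ (y : GL (Fin 2) F) (d : Fin 2 → F), Function.Injective d ∧
          (g : Matrix (Fin 2) (Fin 2) F) = (y : Matrix (Fin 2) (Fin 2) F) * Matrix.diagonal d * ((y⁻¹ : GL (Fin 2) F) : Matrix (Fin 2) (Fin 2) F) := by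
  filter_upwards [ae_exists_mk_eq_discr_ne_zero hϖ hϖ0 μ'] with x hx
  obtain ⟨g, rfl, hD⟩ := hx
  have hsep : (g : Matrix (Fin 2) (Fin 2) F).charpoly.Separable :=
    separable_of_discr_ne_zero (Matrix.charpoly_monic _) (by rw [Matrix.charpoly_natDegree_eq_dim, Fintype.card_fin]; norm_num) hD
  rcases normalForm_of_discr_ne_zero _ hD with h | h
  · exact Or.inr ⟨g, rfl, hsep, h⟩
  · exact Or.inl (isCompact_centralizer_mk_of_irreducible hϖ hϖ0 g h)

end Downstairs

end Summit.HodgeConjecture.HodgeConjecture.Cruxes.H413.K2E3GL2ModUniformizerSeparableAE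

end
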